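import Mathlib.Analysis.SpecialFunctions.Trigonometric.DerivHyp
import Literature.Geometry.Riemannian.VolumeSphereTheoremProofs

/-!
# The Bishop-defect identity along the Einstein Riccati equation

Stub `stub_bishopDefect` of the crux `YamabePinchedEinsteinBulk` (item stmt-SmoothPoincare4-7996,
routes `InformationMetricHadamard` / `EinsteinBulk`), line `Sketch` (card
`tracefree-riccati-defect`, P1a): the one-variable matrix-calculus identity behind the
Bishop–Gromov density DEFECT along a geodesic ray of a Poincaré–Einstein 5-manifold.

In a parallel frame of `γ'^⊥ ≅ ℝ⁴` the shape operator `𝒰(t)` of the distance spheres solves the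
Einstein Riccati equation `𝒰' = 1 − 𝒲 − 𝒰²` (curvature operator `ℛ = −1 + 𝒲`, `𝒲` the radial
Weyl operator, trace-free because `Ric = −4g`), and the defect `D(t) = 4 coth t − tr 𝒰` satisfies
`D' = tr((𝒰°)²) − D (4 coth t + tr 𝒰)/4`, `𝒰° = 𝒰 − (tr 𝒰/4) I`. Proof:
`D' = −4/sinh² t − tr 𝒰' = −4/sinh² t − 4 + tr 𝒲 + tr 𝒰²` (`tr 1 = 4`, `tr 𝒲 = 0`), while
`tr((𝒰°)²) = tr 𝒰² − (tr 𝒰)²/4` and `(4 coth t − H)(4 coth t + H)/4 = 4 coth² t − H²/4`; the two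
sides agree because `−4/sinh² t − 4 = −4 cosh² t/sinh² t` (`cosh² = sinh² + 1`). No geometry is
involved. Helpers (prefixed `bishopDefect_` to stay clear of the sibling stub files of the line):
the two trace computations and the derivative of `coth`.

The registered signature is elaborated WITHOUT `open scoped Matrix.Norms.Operator` (the matrix
`HasDerivAt` hypothesis uses the product topology); the tree's `hasDerivAt_matrix_trace` is stated
under that scope, and the two elaborations are definitionally equal (Mathlib builds the
`L∞`-operator norm over the product uniformity), so the lemma applies to the hypothesis verbatim.
-/

noncomputable section

-- the prescribed namespace `Summit.<P>.<Sub>.…` duplicates `SmoothPoincare4` (P = Sub)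
set_option linter.dupNamespace false

namespace Summit.SmoothPoincare4.SmoothPoincare4.Cruxes.YamabePinchedEinsteinBulk.Sketch

open Literature.Geometry.Riemannian (hasDerivAt_matrix_trace)

/-- Trace of the Einstein Riccati right-hand side: `tr (1 − 𝒲 − 𝒰²) = 4 − tr 𝒰²` on `ℝ⁴` when
`tr 𝒲 = 0`. [folklore] -/
theorem bishopDefect_trace_riccati_rhs (U W : Matrix (Fin 4) (Fin 4) ℝ) (hW : W.trace = 0) :
    (-(-1 + W) - U * U).trace = 4 - (U * U).trace := by
  rw [Matrix.trace_sub, Matrix.trace_neg, Matrix.trace_add, Matrix.trace_neg, Matrix.trace_one,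
    hW, Fintype.card_fin]
  push_cast
  ring

/-- Trace of the square of the trace-free part: `tr ((𝒰 − (tr 𝒰/4) I)²) = tr 𝒰² − (tr 𝒰)²/4`
for a real `4 × 4` matrix. [folklore] -/
theorem bishopDefect_trace_tracefree_sq (U : Matrix (Fin 4) (Fin 4) ℝ) :
    ((U - (U.trace / 4) • (1 : Matrix (Fin 4) (Fin 4) ℝ)) *
        (U - (U.trace / 4) • (1 : Matrix (Fin 4) (Fin 4) ℝ))).trace =
      (U * U).trace - U.trace ^ 2 / 4 := by
  simp only [mul_sub, sub_mul, Matrix.mul_smul, Matrix.smul_mul, Matrix.mul_one, Matrix.one_mul,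
    smul_smul, Matrix.trace_sub, Matrix.trace_smul, Matrix.trace_one, smul_eq_mul, Fintype.card_fin]
  push_cast
  ring

/-- Derivative of `coth = cosh / sinh` away from `0`: `(cosh t / sinh t)' = -1 / sinh² t`
(quotient rule and `cosh² − sinh² = 1`). [folklore] -/
theorem bishopDefect_hasDerivAt_coth {t : ℝ} (ht : Real.sinh t ≠ 0) :
    HasDerivAt (fun s => Real.cosh s / Real.sinh s) (-1 / Real.sinh t ^ 2) t := by
  have h := (Real.hasDerivAt_cosh t).fun_div (Real.hasDerivAt_sinh t) ht
  refine h.congr_deriv ?_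
  have hc : Real.cosh t ^ 2 = Real.sinh t ^ 2 + 1 := Real.cosh_sq t
  congr 1
  nlinarith [hc]

/-- **Bishop-defect identity.** Along a solution of the Einstein Riccati equation
`𝒰' = 1 − 𝒲 − 𝒰²` with `tr 𝒲 = 0` (on `ℝ⁴ = γ'^⊥`), the Bishop–Gromov density defect
`D = 4 coth t − tr 𝒰` satisfies `D' = tr((𝒰°)²) − D (4 coth t + tr 𝒰)/4`, `𝒰° = 𝒰 − (tr 𝒰/4) I`
(`t > 0`). Registered stub `stub_bishopDefect` of line `Sketch`. [folklore] -/
theorem stub_bishopDefect :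
    ∀ (U W : ℝ → Matrix (Fin 4) (Fin 4) ℝ) (t : ℝ), 0 < t →
      HasDerivAt U (-(-1 + W t) - U t * U t) t → (W t).trace = 0 →
      HasDerivAt (fun s => 4 * (Real.cosh s / Real.sinh s) - (U s).trace)
        (((U t - ((U t).trace / 4) • (1 : Matrix (Fin 4) (Fin 4) ℝ)) *
              (U t - ((U t).trace / 4) • (1 : Matrix (Fin 4) (Fin 4) ℝ))).trace -
          (4 * (Real.cosh t / Real.sinh t) - (U t).trace) *
              (4 * (Real.cosh t / Real.sinh t) + (U t).trace) / 4) t := by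
  intro U W t ht hU hW
  have hsinh : Real.sinh t ≠ 0 := (Real.sinh_pos_iff.2 ht).ne'
  -- `(4 coth)' = 4 · (-1 / sinh²)` and `(tr 𝒰)' = tr 𝒰' = tr (1 − 𝒲 − 𝒰²)`
  have hcoth := (bishopDefect_hasDerivAt_coth hsinh).const_mul 4
  have htr : HasDerivAt (fun s => (U s).trace) ((-(-1 + W t) - U t * U t).trace) t :=
    hasDerivAt_matrix_trace hU
  refine (hcoth.fun_sub htr).congr_deriv ?_
  rw [bishopDefect_trace_riccati_rhs _ _ hW, bishopDefect_trace_tracefree_sq]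
  field_simp
  linear_combination 16 * Real.cosh_sq t

end Summit.SmoothPoincare4.SmoothPoincare4.Cruxes.YamabePinchedEinsteinBulk.Sketch

end
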